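import Summits.Ventures.Crystal3D.Theorems.StickyWulffConstantNoReconstructionGainSteepFlatNoGain
import Literature.MathematicalPhysics.StatisticalMechanics.BarlowRings
import HarnessLib

/-!
# No gain near every Barlow film: the `(111)` rung on an open set of off-lattice packings

HONEST FRAMING. Part of the venture `Summits/Ventures/Crystal3D` (cell `crystal3d-full`), helper
`--supports` the crux `NoReconstructionGain` (stmt-Ventures-19144, route
`route-Ventures-StickyWulffConstant`).  The steep-or-flat rung `steepFlat_noGain111`
(`…SteepFlatNoGain.lean`) has an OPEN hypothesis (bond inclinations `|Δz| ≤ 1/5` or `≥ 4/5`).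
Here this is cashed out as a statement about configurations: every unit packing obtained from
(a subset of a translate of) ONE Barlow stacking by displacing each ball by at most `1/150` is
steep-or-flat, hence — if it still contains the fcc `(111)` slab sample — gains nothing over the
two flat faces.  So the no-gain inequality holds on a full-dimensional neighbourhood, in
configuration space, of every registered / restacked / twinned film: it is STABLE under arbitrary
small off-lattice relaxations (rumpling, buckling, in-plane strain, thermal disorder), not merely
exact in registry.

* Input from the tree: the distance gap `(1, √2)` of every Barlow stacking
  (`Literature/…/BarlowRings.lean`, `eq_or_dist_barlowPos_eq_of_lt`, Hales DSP §1.3).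
* `steepOrFlat_of_near_barlowStacking` — a unit packing `x` with `‖x i − y i‖ ≤ 1/150`, all
  `y i` on a translate of one Barlow stacking (`nn` distance `1`), has every bond with
  `|Δz| ≤ 1/5` or `|Δz| ≥ 4/5` (a bond of `x` comes from a pair of `y`-sites at distance
  `< √2`, hence touching, hence in the same or adjacent layers).
* `noGain111_of_near_barlowStacking` — with `R = 2`, `C = 8√3π`: such an `x` containing the fcc
  `(111)` slab sample of radius `ρ ≥ R` has `2√3·π·ρ² − C·ρ ≤ 6N − numContacts x`.

WHAT THIS IS NOT: the atom (large off-lattice rearrangements with oblique bonds remain open);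
nothing about the Crystallization conjunct; rung F-C1 not moved.
-/

noncomputable section

namespace Summit.Ventures.Crystal3D.Theorems

open Summit.Ventures.Crystal3D Finset Real
open Literature.MathematicalPhysics.StatisticalMechanics (barlowPos barlowStacking fccStacking
  IsHaggSeq barlowPos_apply_two dist_barlowPos_eq_iff eq_or_dist_barlowPos_eq_of_lt)
open scoped InnerProductSpace

/-! ## Packings near a Barlow film are steep-or-flat -/

/-- **Near-Barlow packings are steep-or-flat.**  If `x : Fin N → ℝ³` is a unit packing and
`‖x i − y i‖ ≤ 1/150` with every `y i` on a translate `v + barlowStacking 1 √(2/3) σ` of one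
Barlow stacking (`σ` Hägg), then every bond of `x` has `|Δz| ≤ 1/5` or `|Δz| ≥ 4/5`: the shadow
pair `y i, y j` of a bond is at distance `≤ 1 + 2/150 < √2` and `≠ 0`, hence touching, hence in the
same layer (`Δz = 0`) or adjacent layers (`|Δz| = √(2/3) = 0.8165`), and `x`'s `Δz` differs by at
most `2/150`. -/
theorem steepOrFlat_of_near_barlowStacking {N : ℕ} (x y : Fin N → EuclideanSpace ℝ (Fin 3))
    (hx : IsUnitPacking x) (σ : ℤ → ℤ) (hσ : IsHaggSeq σ) (v : EuclideanSpace ℝ (Fin 3))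
    (hmem : ∀ i, y i - v ∈ barlowStacking 1 (Real.sqrt (2 / 3)) σ)
    (hnear : ∀ i, ‖x i - y i‖ ≤ 1 / 150) :
    ∀ i j, dist (x i) (x j) = 1 → |x i 2 - x j 2| ≤ 1 / 5 ∨ 4 / 5 ≤ |x i 2 - x j 2| := by
  have hh : (Real.sqrt (2 / 3)) ^ 2 = 2 / 3 * (1 : ℝ) ^ 2 := by
    rw [Real.sq_sqrt (by norm_num)]; ring
  have h23 : (61 : ℝ) / 75 ≤ Real.sqrt (2 / 3) := by
    rw [show (61 : ℝ) / 75 = Real.sqrt ((61 / 75) ^ 2) by rw [Real.sqrt_sq (by norm_num)]]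
    exact Real.sqrt_le_sqrt (by norm_num)
  have hsqrt2 : (1 : ℝ) + 2 / 150 < Real.sqrt 2 := by
    rw [show (1 : ℝ) + 2 / 150 = Real.sqrt ((1 + 2 / 150) ^ 2) by rw [Real.sqrt_sq (by norm_num)]]
    exact Real.sqrt_lt_sqrt (by norm_num) (by norm_num)
  intro i j hd
  have hij : i ≠ j := by
    intro h; rw [h, dist_self] at hd; exact zero_ne_one hd
  obtain ⟨k, a, b, hk⟩ := hmem i
  obtain ⟨k', a', b', hk'⟩ := hmem j
  -- the shadow pair
  have hyy : dist (y i) (y j) = dist (barlowPos 1 (Real.sqrt (2 / 3)) σ k a b)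
      (barlowPos 1 (Real.sqrt (2 / 3)) σ k' a' b') := by
    rw [← hk, ← hk', dist_eq_norm, dist_eq_norm, sub_sub_sub_cancel_right]
  have hxy : dist (y i) (y j) ≤ dist (x i) (x j) + 2 / 150 := by
    have h1 := dist_triangle (y i) (x i) (x j)
    have h2 := dist_triangle (x i) (x j) (y j)
    have h3 : dist (y i) (x i) ≤ 1 / 150 := by rw [dist_comm, dist_eq_norm]; exact hnear i
    have h4 : dist (x j) (y j) ≤ 1 / 150 := by rw [dist_eq_norm]; exact hnear j
    linarith [dist_triangle (y i) (x i) (y j)]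
  have hyx : dist (x i) (x j) ≤ dist (y i) (y j) + 2 / 150 := by
    have h3 : dist (x i) (y i) ≤ 1 / 150 := by rw [dist_eq_norm]; exact hnear i
    have h4 : dist (y j) (x j) ≤ 1 / 150 := by rw [dist_comm, dist_eq_norm]; exact hnear j
    linarith [dist_triangle (x i) (y i) (x j), dist_triangle (y i) (y j) (x j)]
  have hne : (k, a, b) ≠ (k', a', b') := by
    intro h
    simp only [Prod.mk.injEq] at h
    have : dist (y i) (y j) = 0 := by rw [hyy, h.1, h.2.1, h.2.2, dist_self]
    have h1 := hx hij
    linarith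
  -- the shadow pair touches (distance gap of the stacking)
  have htouch : dist (barlowPos 1 (Real.sqrt (2 / 3)) σ k a b)
      (barlowPos 1 (Real.sqrt (2 / 3)) σ k' a' b') = 1 := by
    have hlt : dist (barlowPos 1 (Real.sqrt (2 / 3)) σ k a b)
        (barlowPos 1 (Real.sqrt (2 / 3)) σ k' a' b') < Real.sqrt 2 * 1 := by
      rw [← hyy, mul_one]; linarith
    exact (eq_or_dist_barlowPos_eq_of_lt hσ one_pos hh hlt).resolve_left hne
  -- hence same or adjacent layers
  have hzy : y i 2 - y j 2 = (k - k' : ℝ) * Real.sqrt (2 / 3) := by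
    have h1 : (y i - v) 2 = k * Real.sqrt (2 / 3) := by rw [hk, barlowPos_apply_two]
    have h2 : (y j - v) 2 = k' * Real.sqrt (2 / 3) := by rw [hk', barlowPos_apply_two]
    rw [PiLp.sub_apply] at h1 h2
    linarith
  -- `x`'s height difference is within `2/150` of `y`'s
  have hclose : |(x i 2 - x j 2) - (y i 2 - y j 2)| ≤ 2 / 150 := by
    have h1 : |x i 2 - y i 2| ≤ 1 / 150 := by
      have := PiLp.norm_apply_le (x i - y i) 2
      rw [PiLp.sub_apply, Real.norm_eq_abs] at this
      exact this.trans (hnear i)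
    have h2 : |x j 2 - y j 2| ≤ 1 / 150 := by
      have := PiLp.norm_apply_le (x j - y j) 2
      rw [PiLp.sub_apply, Real.norm_eq_abs] at this
      exact this.trans (hnear j)
    rw [show (x i 2 - x j 2) - (y i 2 - y j 2) = (x i 2 - y i 2) - (x j 2 - y j 2) by ring]
    exact (abs_sub _ _).trans (by linarith)
  have hpos : 0 ≤ Real.sqrt (2 / 3) := Real.sqrt_nonneg _
  rcases (dist_barlowPos_eq_iff hσ one_pos hh k a b k' a' b').1 htouch with
    ⟨h, -⟩ | ⟨h, -⟩ | ⟨h, -⟩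
  · left
    rw [h, sub_self, zero_mul] at hzy
    rw [hzy, sub_zero] at hclose
    linarith
  · right
    rw [h] at hzy; push_cast at hzy
    have : y i 2 - y j 2 = -Real.sqrt (2 / 3) := by rw [hzy]; ring
    rw [this] at hclose
    have h1 := (abs_le.1 hclose).2
    rw [abs_of_nonpos (by linarith)]
    linarith
  · right
    rw [h] at hzy; push_cast at hzy
    have : y i 2 - y j 2 = Real.sqrt (2 / 3) := by rw [hzy]; ring
    rw [this] at hclose
    have h1 := (abs_le.1 hclose).1
    rw [abs_of_nonneg (by linarith)]
    linarith

/-- **No gain near every Barlow film** (the `(111)` rung on an open set of off-lattice packings).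
With `R = 2`, `C = 8√3π`: for `ρ ≥ R`, every unit packing `x : Fin N → ℝ³` that is within `1/150`
(ball by ball) of points `y i` on a translate of ONE Barlow stacking (any Hägg word — fcc
continuation, twins, faults, hcp overgrowth …) and contains the fcc `(111)` slab sample of lateral
radius `ρ` between heights `−2R` and `−R` satisfies `2√3·π·ρ² − C·ρ ≤ 6N − numContacts x`. -/
theorem noGain111_of_near_barlowStacking :
    ∃ R C : ℝ, 0 < R ∧
      ∀ ρ : ℝ, R ≤ ρ → ∀ (N : ℕ) (x : Fin N → EuclideanSpace ℝ (Fin 3)), IsUnitPacking x →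
        (∃ (σ : ℤ → ℤ) (v : EuclideanSpace ℝ (Fin 3)) (y : Fin N → EuclideanSpace ℝ (Fin 3)),
            IsHaggSeq σ ∧ (∀ i, y i - v ∈ barlowStacking 1 (Real.sqrt (2 / 3)) σ) ∧
              ∀ i, ‖x i - y i‖ ≤ 1 / 150) →
        (∀ p ∈ fccStacking 1 (Real.sqrt (2 / 3)),
            -(2 * R) ≤ p 2 → p 2 ≤ -R → p 0 ^ 2 + p 1 ^ 2 ≤ ρ ^ 2 → ∃ i, x i = p) →
          2 * Real.sqrt 3 * Real.pi * ρ ^ 2 - C * ρ ≤ 6 * (N : ℝ) - (numContacts x : ℝ) := by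
  obtain ⟨R, C, hR, h⟩ := steepFlat_noGain111
  refine ⟨R, C, hR, fun ρ hρ N x hx ⟨σ, v, y, hσ, hmem, hnear⟩ hsample => ?_⟩
  exact h ρ hρ N x hx (steepOrFlat_of_near_barlowStacking x y hx σ hσ v hmem hnear) hsample

end Summit.Ventures.Crystal3D.Theorems

end
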